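import Mathlib.Algebra.Group.Subgroup.Basic
import Mathlib.GroupTheory.Subgroup.Centralizer
import Mathlib.Tactic.Group
import HarnessLib

/-!
# `Z(ε)`-separation SATURATES: if conjugators between points of a slice box `B₁ ⊆ M` lie in `M`, the same holds between points of `Ad(M)·B₁`,
# and every centraliser of a point of `Ad(M)·B₁` lies in `M` (N6nsGerm (S1)∕(S2), slice side of the Ad(M)-invariant descent binder)

Topic `NumberTheory/Automorphic`; namespace `Literature.NumberTheory.Automorphic`. KERNEL mathematics only: theorems, no definition, no named fact, no instance,
no notation, no `sorry`.  Cell `pub/hodgecm-mathlib` (LEAD F0P3a-plan (g9) WORD T8-38 (1) ∕ T8-65 (2); road «N6nsGerm», binder B4 of F0P2-p02 (g8)'s junction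
census a69e3f7c in p08 (g13)'s Ad(M)-INVARIANT reshape 04:53:59Z; p08 «=» 04:54:54Z on this head).  Pure group theory: the (SEP′) conjunct of the slice datum
★ `exists_unitary_sliceDatum` ∕ ★ `exists_sliceDatum_cmDatum_local_centralizer` («`y t y⁻¹ = t′`, `t, t′ ∈ B₁` ⇒ `y ∈ M`», `M = Z(ε₀)`) is stated on a small box
`B₁ ⊆ M`; Harish-Chandra's descent with a cut-off integrates over the `Ad(M)`-SATURATION `Ad(M)·B₁ = {k t k⁻¹ ∣ k ∈ M, t ∈ B₁}`, and there the same separation holds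
by conjugation covariance: `y (k t k⁻¹) y⁻¹ = k′ t′ k′⁻¹ ⇒ (k′⁻¹ y k) t (k′⁻¹ y k)⁻¹ = t′ ⇒ k′⁻¹ y k ∈ M ⇒ y ∈ M`.  In particular (take `m = m′`) the FULL centraliser
`Z_G(m)` of every `m ∈ Ad(M)·B₁` lies in `M`, so `G ∕ Z_G(m)` and `M ∕ Z_M(m)` are quotients by the same group — the bookkeeping fact the descent identity
`Φ^{G}(m, ψ) = Φ^{M}(m, ψ_ε)` uses.

* `mem_of_conj_eq_of_forall_conj_eq_imp_mem` — (SEP′) on `Ad(M)·B₁` from (SEP′) on `B₁`.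
* `centralizer_le_of_forall_conj_eq_imp_mem` — `Z_G(k t k⁻¹) ≤ M` for `k ∈ M`, `t ∈ B₁`.
* `conj_mem_image_conj_of_mem` — `Ad(M)·B₁` is `Ad(M)`-stable (closure of the bookkeeping).

HONEST SCOPE.  Group theory only; HC_CM is proved only modulo the printed citations until rung 0 closes; this file discharges no printed statement.

## References
* [HarishChandra1970] Harish-Chandra (notes by G. van Dijk), *Harmonic Analysis on Reductive p-adic Groups*, LNM 162 (1970), Part II §5 (descent to `M`; `M`-invariant
  neighbourhoods).
* [Rogawski1990] J. D. Rogawski, *Automorphic Representations of Unitary Groups in Three Variables* (1990), §8.2 Prop. 8.2.1 p. 112.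
-/

set_option autoImplicit false

namespace Literature.NumberTheory.Automorphic

variable {G : Type*} [Group G] (T : Subgroup G) {B₁ : Set ↥T}

/-- **(SEP′) saturates under `Ad(T)`**: if every conjugator between two points of `B₁ ⊆ T` lies in `T`, then every conjugator between two points of
`Ad(T)·B₁ = {k t k⁻¹}` lies in `T`. [cite: HarishChandra1970, Part II §5] [cite: Rogawski1990, §8.2 Prop. 8.2.1 p. 112] -/
theorem mem_of_conj_eq_of_forall_conj_eq_imp_mem
    (hsep : ∀ t ∈ B₁, ∀ t' ∈ B₁, ∀ y : G, y * (t : G) * y⁻¹ = (t' : G) → y ∈ T)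
    {k k' : ↥T} {t t' : ↥T} (ht : t ∈ B₁) (ht' : t' ∈ B₁) {y : G}
    (h : y * ((k : G) * (t : G) * (k : G)⁻¹) * y⁻¹ = (k' : G) * (t' : G) * (k' : G)⁻¹) : y ∈ T := by
  have h' : ((k' : G)⁻¹ * y * (k : G)) * (t : G) * ((k' : G)⁻¹ * y * (k : G))⁻¹ = (t' : G) := by
    calc ((k' : G)⁻¹ * y * (k : G)) * (t : G) * ((k' : G)⁻¹ * y * (k : G))⁻¹
        = (k' : G)⁻¹ * (y * ((k : G) * (t : G) * (k : G)⁻¹) * y⁻¹) * (k' : G) := by group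
      _ = (t' : G) := by rw [h]; group
  have hmem : (k' : G)⁻¹ * y * (k : G) ∈ T := hsep t ht t' ht' _ h'
  have h1 : y = (k' : G) * ((k' : G)⁻¹ * y * (k : G)) * (k : G)⁻¹ := by group
  rw [h1]
  exact T.mul_mem (T.mul_mem k'.2 hmem) (T.inv_mem k.2)

/-- **Centralisers of saturated box points lie in `T`**: `Z_G(k t k⁻¹) ≤ T` for `k ∈ T`, `t ∈ B₁` ((SEP′) with `t = t′`). So `G ∕ Z_G(m)` and `T ∕ Z_T(m)` are
quotients by the same subgroup for every `m ∈ Ad(T)·B₁`. [cite: HarishChandra1970, Part II §5] -/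
theorem centralizer_le_of_forall_conj_eq_imp_mem
    (hsep : ∀ t ∈ B₁, ∀ t' ∈ B₁, ∀ y : G, y * (t : G) * y⁻¹ = (t' : G) → y ∈ T)
    {k : ↥T} {t : ↥T} (ht : t ∈ B₁) :
    Subgroup.centralizer ({(k : G) * (t : G) * (k : G)⁻¹} : Set G) ≤ T := by
  intro y hy
  rw [Subgroup.mem_centralizer_singleton_iff] at hy
  refine mem_of_conj_eq_of_forall_conj_eq_imp_mem T hsep (k := k) (k' := k) ht ht (y := y) ?_
  rw [hy, mul_inv_cancel_right]

/-- Unsaturated form: `Z_G(t) ≤ T` for `t ∈ B₁`. [cite: HarishChandra1970, Part II §5] -/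
theorem centralizer_le_of_forall_conj_eq_imp_mem' 
    (hsep : ∀ t ∈ B₁, ∀ t' ∈ B₁, ∀ y : G, y * (t : G) * y⁻¹ = (t' : G) → y ∈ T)
    {t : ↥T} (ht : t ∈ B₁) : Subgroup.centralizer ({(t : G)} : Set G) ≤ T := by
  have h := centralizer_le_of_forall_conj_eq_imp_mem T hsep (k := (1 : ↥T)) ht
  simpa only [OneMemClass.coe_one, one_mul, inv_one, mul_one] using h

/-- `Ad(T)·B₁` is `Ad(T)`-stable: `j (k t k⁻¹) j⁻¹ = (jk) t (jk)⁻¹` (the `M`-invariance of Harish-Chandra's neighbourhoods). [cite: HarishChandra1970, Part II §5] -/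
theorem conj_mem_image_conj_of_mem {j k : ↥T} {t : ↥T} :
    (j : G) * ((k : G) * (t : G) * (k : G)⁻¹) * (j : G)⁻¹ = ((j * k : ↥T) : G) * (t : G) * ((j * k : ↥T) : G)⁻¹ := by
  rw [Subgroup.coe_mul]
  group

end Literature.NumberTheory.Automorphic
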